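import Mathlib
import Summits.PneNP.PneNP.Theorems.ConvexRankGatesConvexGateBlindExactLiftingTriangleDegreeTwoMoments

/-!
# PneNP / ConvexRankGates — `ConvexGateBlind`, line `xor-door-perfect-completeness`:
# asymptotic DEGREE-2 BLINDNESS of the triangle instance, table side II: sub-cube averages and the line
# conditions (lead c5)

Registered sub-goal `degreeTwo_line_conditions` of crux item stmt-PneNP-10680 (line
`xor-door-perfect-completeness`, open stub `stub_exactLifting : XorDoor.ExactLifting`).

Continues `…TriangleDegreeTwoMoments.lean`.  From non-negativity of a degree-2 row function
`a = α + quad A⁰¹ A¹² A⁰² ≥ 0`: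

* `subcube_avg₂` — averaging `a` over the sub-cube of tables with the bits at `(0,π)`, `(1,ρ)` and all of
  block 2 prescribed (flips of the free bits kill every other term, `sum_mul_eq_zero_of_flip`; the
  surviving signs are constant on the sub-cube, `sum_mul_of_const_on_supp`) gives
  `0 ≤ α + s(u)s(v)A⁰¹(π,ρ) + Σ_σ s(e σ)(s(v)A¹²(ρ,σ) + s(u)A⁰²(π,σ))` for all bits `u, v` and every
  prescription `e` of block 2;
* `lineCond₂` — prescribing block 2 against the signs of `A¹²(ρ,·) + A⁰²(π,·)` (with `u = v`) and taking
  `u ≠ v` with block 2 constant (twice, opposite signs) yields the LINE CONDITION of the pointer-side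
  theorem in direction 2: `Σ_σ (F(π,ρ,σ) − α)₊ ≤ 2α`, `F = A⁰¹(π,ρ) + A¹²(ρ,σ) + A⁰²(π,σ)`;
  `lineCond₀`, `lineCond₁` — the other two directions by relabelling the blocks (`quad_perm₀/₁`);
* `degreeTwo_line_conditions` (registered) packages the three.

No new definitions.
-/

set_option linter.dupNamespace false -- `Summit.PneNP.PneNP.…`: summit = sub-problem (D-0017)

namespace Summit.PneNP.PneNP.Theorems.XorDoor

open scoped BigOperators
open Finset TriangleInst

noncomputable section

namespace TriDegTwo

variable {t : ℕ}

/-! ## §4 The line conditions from non-negativity on sub-cubes -/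

/-- A weight supported where `f` is constant pairs to that constant. -/
theorem sum_mul_of_const_on_supp (f q : (Fin 3 → Fin t → ZMod 2) → ℝ) (c : ℝ)
    (h : ∀ x, q x ≠ 0 → f x = c) : ∑ x, f x * q x = c * ∑ x, q x := by
  rw [Finset.mul_sum]
  refine Finset.sum_congr rfl fun x _ => ?_
  by_cases hq : q x = 0
  · rw [hq, mul_zero, mul_zero]
  · rw [h x hq]

/-- A weight invariant under a bit flip kills every term that changes sign under it. -/
theorem sum_mul_eq_zero_of_flip (i : Fin 3) (π : Fin t) (f q : (Fin 3 → Fin t → ZMod 2) → ℝ)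
    (hf : ∀ x, f (flipAt i π x) = - f x) (hq : ∀ x, q (flipAt i π x) = q x) :
    ∑ x, f x * q x = 0 :=
  sum_eq_zero_of_flip i π _ fun x => by rw [hf, hq]; ring

/-- **Sub-cube average, direction 2.** For a degree-2 row function `a = α + quad ≥ 0`, bits `u` at
`(0,π)` and `v` at `(1,ρ)` and a prescription `e` of block 2:
`0 ≤ α + s(u)s(v)A⁰¹(π,ρ) + Σ_σ s(e σ)(s(v)A¹²(ρ,σ) + s(u)A⁰²(π,σ))`. -/
theorem subcube_avg₂ (α : ℝ) (A01 A12 A02 : Fin t → Fin t → ℝ) (a : (Fin 3 → Fin t → ZMod 2) → ℝ)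
    (ha : ∀ x, a x = α + quad A01 A12 A02 x) (hpos : ∀ x, 0 ≤ a x)
    (π ρ : Fin t) (u v : ZMod 2) (e : Fin t → ZMod 2) :
    0 ≤ α + sgnR u * sgnR v * A01 π ρ + ∑ σ, sgnR (e σ) * (sgnR v * A12 ρ σ + sgnR u * A02 π σ) := by
  classical
  -- the indicator of the sub-cube
  let q : (Fin 3 → Fin t → ZMod 2) → ℝ := fun x =>
    if x 0 π = u ∧ x 1 ρ = v ∧ ∀ σ, x 2 σ = e σ then 1 else 0
  have hqnn : ∀ x, 0 ≤ q x := fun x => by simp only [q]; split_ifs <;> norm_num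
  -- the sub-cube is non-empty
  let x₀ : Fin 3 → Fin t → ZMod 2 := fun j σ => if j = 0 then u else if j = 1 then v else e σ
  have hq0 : q x₀ = 1 := by
    simp [q, x₀]
  have hN : 0 < ∑ x, q x :=
    lt_of_lt_of_le (by rw [hq0]; norm_num) (Finset.single_le_sum (fun x _ => hqnn x) (Finset.mem_univ x₀))
  -- values of the signs on the support
  have hsupp : ∀ x, q x ≠ 0 → x 0 π = u ∧ x 1 ρ = v ∧ ∀ σ, x 2 σ = e σ := by
    intro x hx; by_contra hno; exact hx (by simp only [q, if_neg hno])
  -- invariance of `q` under flips of free bits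
  have hq_flip0 : ∀ π', π' ≠ π → ∀ x, q (flipAt 0 π' x) = q x := by
    intro π' hπ' x
    have e1 : flipAt 0 π' x 0 π = x 0 π := by
      show (if (0 : Fin 3) = 0 ∧ π = π' then x 0 π + 1 else x 0 π) = x 0 π
      rw [if_neg (fun h => hπ' h.2.symm)]
    have e2 : flipAt 0 π' x 1 ρ = x 1 ρ := by
      show (if (1 : Fin 3) = 0 ∧ ρ = π' then x 1 ρ + 1 else x 1 ρ) = x 1 ρ
      rw [if_neg (fun h => absurd h.1 (by decide))]
    have e3 : ∀ σ, flipAt 0 π' x 2 σ = x 2 σ := by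
      intro σ
      show (if (2 : Fin 3) = 0 ∧ σ = π' then x 2 σ + 1 else x 2 σ) = x 2 σ
      rw [if_neg (fun h => absurd h.1 (by decide))]
    simp only [q, e1, e2, e3]
  have hq_flip1 : ∀ ρ', ρ' ≠ ρ → ∀ x, q (flipAt 1 ρ' x) = q x := by
    intro ρ' hρ' x
    have e1 : flipAt 1 ρ' x 0 π = x 0 π := by
      show (if (0 : Fin 3) = 1 ∧ π = ρ' then x 0 π + 1 else x 0 π) = x 0 π
      rw [if_neg (fun h => absurd h.1 (by decide))]
    have e2 : flipAt 1 ρ' x 1 ρ = x 1 ρ := by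
      show (if (1 : Fin 3) = 1 ∧ ρ = ρ' then x 1 ρ + 1 else x 1 ρ) = x 1 ρ
      rw [if_neg (fun h => hρ' h.2.symm)]
    have e3 : ∀ σ, flipAt 1 ρ' x 2 σ = x 2 σ := by
      intro σ
      show (if (2 : Fin 3) = 1 ∧ σ = ρ' then x 2 σ + 1 else x 2 σ) = x 2 σ
      rw [if_neg (fun h => absurd h.1 (by decide))]
    simp only [q, e1, e2, e3]
  -- the pairing `Σ a q`
  have hmain : ∑ x, a x * q x =
      (α + sgnR u * sgnR v * A01 π ρ + ∑ σ, sgnR (e σ) * (sgnR v * A12 ρ σ + sgnR u * A02 π σ)) * ∑ x, q x := by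
    -- constant term
    have hc : ∑ x, α * q x = α * ∑ x, q x := by rw [Finset.mul_sum]
    -- A01 terms
    have h01 : ∀ π' ρ', ∑ x, (A01 π' ρ' * sg x 0 π' * sg x 1 ρ') * q x =
        (if π' = π ∧ ρ' = ρ then A01 π ρ * (sgnR u * sgnR v) else 0) * ∑ x, q x := by
      intro π' ρ'
      by_cases hπ : π' = π
      · by_cases hρ : ρ' = ρ
        · subst hπ; subst hρ; rw [if_pos ⟨rfl, rfl⟩]
          refine sum_mul_of_const_on_supp _ _ _ fun x hx => ?_
          obtain ⟨hu, hv, -⟩ := hsupp x hx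
          simp only [sg, hu, hv]; ring
        · rw [if_neg (fun h => hρ h.2), zero_mul]
          refine sum_mul_eq_zero_of_flip 1 ρ' _ _ (fun x => ?_) (hq_flip1 ρ' hρ)
          rw [sg_flip_same, sg_flip_of_ne (by decide : (0 : Fin 3) ≠ 1)]; ring
      · rw [if_neg (fun h => hπ h.1), zero_mul]
        refine sum_mul_eq_zero_of_flip 0 π' _ _ (fun x => ?_) (hq_flip0 π' hπ)
        rw [sg_flip_same, sg_flip_of_ne (by decide : (1 : Fin 3) ≠ 0)]; ring
    -- A12 terms
    have h12 : ∀ π' ρ', ∑ x, (A12 π' ρ' * sg x 1 π' * sg x 2 ρ') * q x =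
        (if π' = ρ then A12 ρ ρ' * (sgnR v * sgnR (e ρ')) else 0) * ∑ x, q x := by
      intro π' ρ'
      by_cases hπ : π' = ρ
      · subst hπ; rw [if_pos rfl]
        refine sum_mul_of_const_on_supp _ _ _ fun x hx => ?_
        obtain ⟨-, hv, he⟩ := hsupp x hx
        simp only [sg, hv, he ρ']; ring
      · rw [if_neg hπ, zero_mul]
        refine sum_mul_eq_zero_of_flip 1 π' _ _ (fun x => ?_) (hq_flip1 π' hπ)
        rw [sg_flip_same, sg_flip_of_ne (by decide : (2 : Fin 3) ≠ 1)]; ring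
    -- A02 terms
    have h02 : ∀ π' ρ', ∑ x, (A02 π' ρ' * sg x 0 π' * sg x 2 ρ') * q x =
        (if π' = π then A02 π ρ' * (sgnR u * sgnR (e ρ')) else 0) * ∑ x, q x := by
      intro π' ρ'
      by_cases hπ : π' = π
      · subst hπ; rw [if_pos rfl]
        refine sum_mul_of_const_on_supp _ _ _ fun x hx => ?_
        obtain ⟨hu, -, he⟩ := hsupp x hx
        simp only [sg, hu, he ρ']; ring
      · rw [if_neg hπ, zero_mul]
        refine sum_mul_eq_zero_of_flip 0 π' _ _ (fun x => ?_) (hq_flip0 π' hπ)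
        rw [sg_flip_same, sg_flip_of_ne (by decide : (2 : Fin 3) ≠ 0)]; ring
    -- assemble: Σ_x a q = Σ_x α q + Σ_{π',ρ'} Σ_x (three terms) q
    have hexp : ∑ x, a x * q x = ∑ x, α * q x + ∑ π', ∑ ρ', (∑ x, (A01 π' ρ' * sg x 0 π' * sg x 1 ρ') * q x
        + ∑ x, (A12 π' ρ' * sg x 1 π' * sg x 2 ρ') * q x + ∑ x, (A02 π' ρ' * sg x 0 π' * sg x 2 ρ') * q x) := by
      have step : ∀ x, a x * q x = α * q x + ∑ π', ∑ ρ', ((A01 π' ρ' * sg x 0 π' * sg x 1 ρ') * q x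
          + (A12 π' ρ' * sg x 1 π' * sg x 2 ρ') * q x + (A02 π' ρ' * sg x 0 π' * sg x 2 ρ') * q x) := by
        intro x; rw [ha x]; simp only [quad, add_mul, Finset.sum_mul]
      rw [Finset.sum_congr rfl (fun x _ => step x), Finset.sum_add_distrib]
      congr 1
      rw [Finset.sum_comm]
      refine Finset.sum_congr rfl fun π' _ => ?_
      rw [Finset.sum_comm]
      refine Finset.sum_congr rfl fun ρ' _ => ?_
      rw [Finset.sum_add_distrib, Finset.sum_add_distrib]
    rw [hexp, hc]
    simp only [h01, h12, h02]
    -- collapse the Kronecker sums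
    have hK01 : ∑ π', ∑ ρ', (if π' = π ∧ ρ' = ρ then A01 π ρ * (sgnR u * sgnR v) else 0) * ∑ x, q x =
        A01 π ρ * (sgnR u * sgnR v) * ∑ x, q x := by
      rw [Finset.sum_eq_single π]
      · rw [Finset.sum_eq_single ρ]
        · rw [if_pos ⟨rfl, rfl⟩]
        · intro ρ' _ h; rw [if_neg (fun h' => h h'.2), zero_mul]
        · intro h; exact absurd (Finset.mem_univ ρ) h
      · intro π' _ h; refine Finset.sum_eq_zero fun ρ' _ => ?_; rw [if_neg (fun h' => h h'.1), zero_mul]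
      · intro h; exact absurd (Finset.mem_univ π) h
    have hK12 : ∑ π', ∑ ρ', (if π' = ρ then A12 ρ ρ' * (sgnR v * sgnR (e ρ')) else 0) * ∑ x, q x =
        (∑ ρ', A12 ρ ρ' * (sgnR v * sgnR (e ρ'))) * ∑ x, q x := by
      rw [Finset.sum_eq_single ρ]
      · simp only [if_true, Finset.sum_mul]
      · intro π' _ h; refine Finset.sum_eq_zero fun ρ' _ => ?_; rw [if_neg h, zero_mul]
      · intro h; exact absurd (Finset.mem_univ ρ) h
    have hK02 : ∑ π', ∑ ρ', (if π' = π then A02 π ρ' * (sgnR u * sgnR (e ρ')) else 0) * ∑ x, q x =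
        (∑ ρ', A02 π ρ' * (sgnR u * sgnR (e ρ'))) * ∑ x, q x := by
      rw [Finset.sum_eq_single π]
      · simp only [if_true, Finset.sum_mul]
      · intro π' _ h; refine Finset.sum_eq_zero fun ρ' _ => ?_; rw [if_neg h, zero_mul]
      · intro h; exact absurd (Finset.mem_univ π) h
    simp only [Finset.sum_add_distrib, hK01, hK12, hK02]
    have hsum2 : (∑ ρ', A12 ρ ρ' * (sgnR v * sgnR (e ρ'))) + ∑ ρ', A02 π ρ' * (sgnR u * sgnR (e ρ')) =
        ∑ σ, sgnR (e σ) * (sgnR v * A12 ρ σ + sgnR u * A02 π σ) := by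
      rw [← Finset.sum_add_distrib]; exact Finset.sum_congr rfl fun σ _ => by ring
    rw [← hsum2]; ring
  -- conclude from `Σ a q ≥ 0` and `Σ q > 0`
  have hge : 0 ≤ ∑ x, a x * q x := Finset.sum_nonneg fun x _ => mul_nonneg (hpos x) (hqnn x)
  rw [hmain] at hge
  by_contra hneg
  push Not at hneg
  have := mul_neg_of_neg_of_pos hneg hN
  linarith

/-- **Line condition, direction 2.** `Σ_σ (F(π,ρ,σ) − α)₊ ≤ 2α` for a degree-2 row function `≥ 0`. -/
theorem lineCond₂ (α : ℝ) (A01 A12 A02 : Fin t → Fin t → ℝ) (a : (Fin 3 → Fin t → ZMod 2) → ℝ)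
    (ha : ∀ x, a x = α + quad A01 A12 A02 x) (hpos : ∀ x, 0 ≤ a x) (π ρ : Fin t) :
    ∑ σ, max (Fpair A01 A12 A02 (π, ρ, σ) - α) 0 ≤ 2 * α := by
  have key := subcube_avg₂ α A01 A12 A02 a ha hpos π ρ
  set g : Fin t → ℝ := fun σ => A12 ρ σ + A02 π σ with hg
  -- (a) `A⁰¹(π,ρ) ≤ α`: the sub-cubes `s₀π = 1, s₁ρ = −1`, block 2 all `+` resp. all `−`
  have hA01 : A01 π ρ ≤ α := by
    have h1 := key 0 1 (fun _ => 0)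
    have h2 := key 0 1 (fun _ => 1)
    have e1 : α + sgnR 0 * sgnR 1 * A01 π ρ + ∑ σ, sgnR ((fun _ : Fin t => (0 : ZMod 2)) σ) * (sgnR 1 * A12 ρ σ + sgnR 0 * A02 π σ)
        = α - A01 π ρ + ∑ σ, (A02 π σ - A12 ρ σ) := by
      rw [sgnR_zero, sgnR_one]
      have : ∑ σ, sgnR ((fun _ : Fin t => (0 : ZMod 2)) σ) * (-1 * A12 ρ σ + 1 * A02 π σ) = ∑ σ, (A02 π σ - A12 ρ σ) :=
        Finset.sum_congr rfl fun σ _ => by rw [sgnR_zero]; ring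
      rw [this]; ring
    have e2 : α + sgnR 0 * sgnR 1 * A01 π ρ + ∑ σ, sgnR ((fun _ : Fin t => (1 : ZMod 2)) σ) * (sgnR 1 * A12 ρ σ + sgnR 0 * A02 π σ)
        = α - A01 π ρ - ∑ σ, (A02 π σ - A12 ρ σ) := by
      rw [sgnR_zero, sgnR_one]
      have : ∑ σ, sgnR ((fun _ : Fin t => (1 : ZMod 2)) σ) * (-1 * A12 ρ σ + 1 * A02 π σ) = - ∑ σ, (A02 π σ - A12 ρ σ) := by
        rw [← Finset.sum_neg_distrib]; exact Finset.sum_congr rfl fun σ _ => by rw [sgnR_one]; ring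
      rw [this]; ring
    rw [e1] at h1; rw [e2] at h2
    linarith
  -- (b) `Σ_σ |g σ| ≤ α + A⁰¹(π,ρ)`: the sub-cube `s₀π = s₁ρ = 1`, block 2 against the signs of `g`
  let e : Fin t → ZMod 2 := fun σ => if 0 ≤ g σ then 1 else 0
  have he : ∀ σ, sgnR (e σ) * (A12 ρ σ + A02 π σ) = - |g σ| := by
    intro σ
    show sgnR (if 0 ≤ g σ then 1 else 0) * (A12 ρ σ + A02 π σ) = - |g σ|
    by_cases hσ : 0 ≤ g σ
    · rw [if_pos hσ, sgnR_one, abs_of_nonneg hσ, hg]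
      ring
    · rw [if_neg hσ, sgnR_zero, abs_of_neg (lt_of_not_ge hσ), hg]
      ring
  have hsum_abs : ∑ σ, |g σ| ≤ α + A01 π ρ := by
    have h3 := key 0 0 e
    have e3 : α + sgnR 0 * sgnR 0 * A01 π ρ + ∑ σ, sgnR (e σ) * (sgnR 0 * A12 ρ σ + sgnR 0 * A02 π σ)
        = α + A01 π ρ - ∑ σ, |g σ| := by
      rw [sgnR_zero]
      have : ∑ σ, sgnR (e σ) * (1 * A12 ρ σ + 1 * A02 π σ) = - ∑ σ, |g σ| := by
        rw [← Finset.sum_neg_distrib]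
        exact Finset.sum_congr rfl fun σ _ => by rw [one_mul, one_mul]; exact he σ
      rw [this]; ring
    rw [e3] at h3
    linarith
  -- (c) combine
  calc ∑ σ, max (Fpair A01 A12 A02 (π, ρ, σ) - α) 0 ≤ ∑ σ, |g σ| := by
        refine Finset.sum_le_sum fun σ _ => ?_
        have h1 : Fpair A01 A12 A02 (π, ρ, σ) - α ≤ |g σ| := by
          have := le_abs_self (g σ)
          simp only [Fpair, hg] at this ⊢
          linarith
        exact max_le h1 (abs_nonneg _)
    _ ≤ 2 * α := by linarith

/-! ## §5 The other two directions by relabelling the blocks -/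

/-- Block relabelling `y₀ = x₂, y₁ = x₀, y₂ = x₁` turns direction-0 lines of `a` into direction-2 lines. -/
theorem quad_perm₀ (A01 A12 A02 : Fin t → Fin t → ℝ) (x : Fin 3 → Fin t → ZMod 2) :
    quad A01 A12 A02 (fun i => x (![2, 0, 1] i)) =
      quad A12 (fun π ρ => A02 ρ π) (fun π ρ => A01 ρ π) x := by
  simp only [quad, sg]
  have e0 : (![2, 0, 1] : Fin 3 → Fin 3) 0 = 2 := rfl
  have e1 : (![2, 0, 1] : Fin 3 → Fin 3) 1 = 0 := rfl
  have e2 : (![2, 0, 1] : Fin 3 → Fin 3) 2 = 1 := rfl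
  simp only [e0, e1, e2]
  -- split into the three groups and swap the summation indices in the first and third
  simp only [Finset.sum_add_distrib]
  have h1 : ∑ π, ∑ ρ, A01 π ρ * sgnR (x 2 π) * sgnR (x 0 ρ) = ∑ π, ∑ ρ, A01 ρ π * sgnR (x 0 π) * sgnR (x 2 ρ) := by
    rw [Finset.sum_comm]; refine Finset.sum_congr rfl fun π _ => Finset.sum_congr rfl fun ρ _ => ?_; ring
  have h3 : ∑ π, ∑ ρ, A02 π ρ * sgnR (x 2 π) * sgnR (x 1 ρ) = ∑ π, ∑ ρ, A02 ρ π * sgnR (x 1 π) * sgnR (x 2 ρ) := by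
    rw [Finset.sum_comm]; refine Finset.sum_congr rfl fun π _ => Finset.sum_congr rfl fun ρ _ => ?_; ring
  rw [h1, h3]
  ring

/-- Block relabelling `y₀ = x₀, y₁ = x₂, y₂ = x₁` turns direction-1 lines of `a` into direction-2 lines. -/
theorem quad_perm₁ (A01 A12 A02 : Fin t → Fin t → ℝ) (x : Fin 3 → Fin t → ZMod 2) :
    quad A01 A12 A02 (fun i => x (![0, 2, 1] i)) =
      quad A02 (fun π ρ => A12 ρ π) A01 x := by
  simp only [quad, sg]
  have e0 : (![0, 2, 1] : Fin 3 → Fin 3) 0 = 0 := rfl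
  have e1 : (![0, 2, 1] : Fin 3 → Fin 3) 1 = 2 := rfl
  have e2 : (![0, 2, 1] : Fin 3 → Fin 3) 2 = 1 := rfl
  simp only [e0, e1, e2]
  simp only [Finset.sum_add_distrib]
  have h2 : ∑ π, ∑ ρ, A12 π ρ * sgnR (x 2 π) * sgnR (x 1 ρ) = ∑ π, ∑ ρ, A12 ρ π * sgnR (x 1 π) * sgnR (x 2 ρ) := by
    rw [Finset.sum_comm]; refine Finset.sum_congr rfl fun π _ => Finset.sum_congr rfl fun ρ _ => ?_; ring
  rw [h2]
  ring

/-- **Line condition, direction 0.** -/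
theorem lineCond₀ (α : ℝ) (A01 A12 A02 : Fin t → Fin t → ℝ) (a : (Fin 3 → Fin t → ZMod 2) → ℝ)
    (ha : ∀ x, a x = α + quad A01 A12 A02 x) (hpos : ∀ x, 0 ≤ a x) (ρ σ : Fin t) :
    ∑ π, max (Fpair A01 A12 A02 (π, ρ, σ) - α) 0 ≤ 2 * α := by
  let a' : (Fin 3 → Fin t → ZMod 2) → ℝ := fun x => a (fun i => x (![2, 0, 1] i))
  have ha' : ∀ x, a' x = α + quad A12 (fun π ρ => A02 ρ π) (fun π ρ => A01 ρ π) x := fun x => by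
    show a (fun i => x (![2, 0, 1] i)) = _
    rw [ha, quad_perm₀]
  have h := lineCond₂ α A12 (fun π ρ => A02 ρ π) (fun π ρ => A01 ρ π) a' ha' (fun x => hpos _) ρ σ
  have hF : ∀ π, Fpair A01 A12 A02 (π, ρ, σ) = Fpair A12 (fun π ρ => A02 ρ π) (fun π ρ => A01 ρ π) (ρ, σ, π) := by
    intro π; simp only [Fpair]; ring
  simp only [hF]
  exact h

/-- **Line condition, direction 1.** -/
theorem lineCond₁ (α : ℝ) (A01 A12 A02 : Fin t → Fin t → ℝ) (a : (Fin 3 → Fin t → ZMod 2) → ℝ)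
    (ha : ∀ x, a x = α + quad A01 A12 A02 x) (hpos : ∀ x, 0 ≤ a x) (π σ : Fin t) :
    ∑ ρ, max (Fpair A01 A12 A02 (π, ρ, σ) - α) 0 ≤ 2 * α := by
  let a' : (Fin 3 → Fin t → ZMod 2) → ℝ := fun x => a (fun i => x (![0, 2, 1] i))
  have ha' : ∀ x, a' x = α + quad A02 (fun π ρ => A12 ρ π) A01 x := fun x => by
    show a (fun i => x (![0, 2, 1] i)) = _
    rw [ha, quad_perm₁]
  have h := lineCond₂ α A02 (fun π ρ => A12 ρ π) A01 a' ha' (fun x => hpos _) π σ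
  have hF : ∀ ρ, Fpair A01 A12 A02 (π, ρ, σ) = Fpair A02 (fun π ρ => A12 ρ π) A01 (π, σ, ρ) := by
    intro ρ; simp only [Fpair]; ring
  simp only [hF]
  exact h

end TriDegTwo

/-- **Registered sub-goal `degreeTwo_line_conditions` of stmt-PneNP-10680** (by name): for a non-negative
degree-2 row function `a = α + quad A⁰¹ A¹² A⁰²` on the tables, the pair function
`F(π,ρ,σ) = A⁰¹(π,ρ) + A¹²(ρ,σ) + A⁰²(π,σ)` has total excess `Σ (F − α)₊ ≤ 2α` on every axis-parallel line
of the pointer cube. -/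
theorem degreeTwo_line_conditions : ∀ (t : ℕ) (α : ℝ) (A01 A12 A02 : Fin t → Fin t → ℝ)
    (a : (Fin 3 → Fin t → ZMod 2) → ℝ), (∀ x, a x = α + TriDegTwo.quad A01 A12 A02 x) → (∀ x, 0 ≤ a x) →
    (∀ ρ σ, ∑ π, max (A01 π ρ + A12 ρ σ + A02 π σ - α) 0 ≤ 2 * α) ∧
    (∀ π σ, ∑ ρ, max (A01 π ρ + A12 ρ σ + A02 π σ - α) 0 ≤ 2 * α) ∧
    (∀ π ρ, ∑ σ, max (A01 π ρ + A12 ρ σ + A02 π σ - α) 0 ≤ 2 * α) :=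
  fun _ α A01 A12 A02 a ha hpos =>
    ⟨fun ρ σ => TriDegTwo.lineCond₀ α A01 A12 A02 a ha hpos ρ σ,
     fun π σ => TriDegTwo.lineCond₁ α A01 A12 A02 a ha hpos π σ,
     fun π ρ => TriDegTwo.lineCond₂ α A01 A12 A02 a ha hpos π ρ⟩

end

end Summit.PneNP.PneNP.Theorems.XorDoor
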